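import Summits.AtomisticToContinuum.HydrodynamicLimit.Theorems.CollisionIsometryCLTAdaptedWeightCLTBHContactToMassHellinger
import Summits.AtomisticToContinuum.HydrodynamicLimit.Theorems.CollisionIsometryCLTAdaptedWeightCLTBHDVTransferChaos
import Summits.AtomisticToContinuum.HydrodynamicLimit.Theorems.CollisionIsometryCLTAdaptedWeightCLTBHEntropyBudgetWeights
import Summits.AtomisticToContinuum.HydrodynamicLimit.Theorems.CollisionIsometryCLTAdaptedWeightCLTTLStubReduction
import Summits.AtomisticToContinuum.HydrodynamicLimit.Theorems.CollisionIsometryCLTAdaptedWeightCLTTLPastDampingTorus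
import Mathlib.MeasureTheory.Function.SpecialFunctions.Basic

/-!
# Stub `stub_eepClosure` (S5) of the line `block-h-dissipation-closure`, helper file 10: MEASURABILITY and
INTEGRABILITY of the mass-weighted dissipation density along a good orbit
(crux `CollisionIsometryCLT.AdaptedWeightCLT`, stmt-AtomisticToContinuum-14868; `--supports`)

The bookkeeping that makes `massDiss` (the hypothesis `DissipSmallOn` of `stub_eepClosure`) an HONEST iterated
integral, so that a pathwise upper bound of the crux functional by `massDiss` can be integrated (a non-integrable
integrand would give the Bochner junk value `0` and make `DissipSmallOn` vacuous):
* `measurable_cellLaw_param` — `(w, x, v) ↦ f̂_{w,x}(v)` is jointly measurable (continuous kernel; the junk `0⁻¹ = 0`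
  of empty cells is measurable; the Maxwellian along measurable parameters is the landed
  `EntropyBudget.measurable_lM_param`);
* `measurable_hellDiss_cellLaw` — `(w, x) ↦ 𝒟h(f̂_{w,x})` is measurable (parametric Bochner integrals over the
  s-finite pair space, `StronglyMeasurable.integral_prod_right'`);
* along a good orbit `s ↦ Φ_s z` (measurable in time, landed `Reduction.measurable_flow_of_mem_good`):
  `(s, x) ↦ ρ̄ 𝒟h(f̂_{s,x})` is jointly measurable and bounded by `‖ψ_N‖_∞` (`𝒟h ∈ [0,1]`, landed
  `ContactToMass.hellDiss_cellLaw_mem_Icc`), hence has genuine iterated integrals (`integrable_massDissDensity`), and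
  so does the mass-weighted Gaussian moment density `(s, x) ↦ (N+1)⁻¹ Σ_i ψ_N(x_i(s) − x) e^{λ|v_i(s)|²}`
  (`integrable_expDensity`), whose `x`-integral is the empirical Gaussian moment (`integral_expDensity`).
No definitions. Registered anchor: `bhEEPClosure_measurable_anchor` (measurability of `(w, x) ↦ 𝒟h(f̂_{w,x})`).
-/

namespace Summit.AtomisticToContinuum.HydrodynamicLimit.Theorems.BlockHDissipation

open scoped BigOperators Topology Classical MeasureTheory ENNReal InnerProductSpace
open Filter Set MeasureTheory Real
open Literature.Analysis.FluidPDE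
open Summit.AtomisticToContinuum.HydrodynamicLimit.Theorems.ContactSourceDuhamel (T3 V3 Cfg Vel Flow Flows wgt)
open Summit.AtomisticToContinuum.HydrodynamicLimit.Theorems.ContactSourceDuhamel.TimeLocal (AdmissibleKernel)
open Summit.AtomisticToContinuum.HydrodynamicLimit.Theorems.ContactSourceDuhamel.TimeLocal.Reduction
  (measurable_flow_of_mem_good integrable_of_bdd vR norm_vel_flow_le)
open Summit.AtomisticToContinuum.HydrodynamicLimit.Theorems.ContactSourceDuhamel.TimeLocal.PastDamping
  (integral_sum_wgt_mul)
open Literature.MathematicalPhysics.KineticTheory (collide hardSphereKernel sphereMeasure)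

noncomputable section

namespace EEP

variable {N : ℕ} {ψ : ℕ → T3 → ℝ}

/-! ## Joint measurability of the cell objects -/

section Param

variable (hψc : Continuous (ψ N))
include hψc

/-- `(w, x) ↦ ψ_N(x_i − x)` is measurable. -/
theorem measurable_cw_param (i : Fin (N + 1)) : Measurable fun a : Cfg N × T3 => cw N ψ a.1 a.2 i :=
  hψc.measurable.comp (((Geometry.IsMeasurable.measurable_pos i).comp measurable_fst).sub measurable_snd)

/-- `(w, x) ↦ W_x` is measurable. -/
theorem measurable_cW_param : Measurable fun a : Cfg N × T3 => cW N ψ a.1 a.2 :=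
  Finset.measurable_sum _ fun i _ => measurable_cw_param hψc i

omit hψc in
/-- The velocity of particle `i` as a function of `(w, x)` is measurable. -/
theorem measurable_vel_param (i : Fin (N + 1)) : Measurable fun a : Cfg N × T3 => (a.1 i).2 :=
  (Geometry.IsMeasurable.measurable_vel i).comp measurable_fst

/-- `(w, x) ↦ ū_x` is measurable. -/
theorem measurable_cU_param : Measurable fun a : Cfg N × T3 => cU N ψ a.1 a.2 := by
  have hS : Measurable fun a : Cfg N × T3 => ∑ i, cw N ψ a.1 a.2 i • (a.1 i).2 :=
    Finset.measurable_sum _ fun i _ => (measurable_cw_param hψc i).smul (measurable_vel_param i)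
  have hW : Measurable fun a : Cfg N × T3 => (cW N ψ a.1 a.2)⁻¹ := (measurable_cW_param hψc).inv
  exact hW.smul hS

/-- `(w, x) ↦ θ̄_x` is measurable. -/
theorem measurable_cT_param : Measurable fun a : Cfg N × T3 => cT N ψ a.1 a.2 := by
  have hd : ∀ i : Fin (N + 1), Measurable fun a : Cfg N × T3 => ‖(a.1 i).2 - cU N ψ a.1 a.2‖ ^ 2 / 3 := fun i =>
    (((measurable_vel_param i).sub (measurable_cU_param hψc)).norm.pow_const 2).div_const 3
  have hS : Measurable fun a : Cfg N × T3 => ∑ i, cw N ψ a.1 a.2 i * (‖(a.1 i).2 - cU N ψ a.1 a.2‖ ^ 2 / 3) :=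
    Finset.measurable_sum _ fun i _ => (measurable_cw_param hψc i).mul (hd i)
  have hW : Measurable fun a : Cfg N × T3 => (cW N ψ a.1 a.2)⁻¹ := (measurable_cW_param hψc).inv
  exact hW.mul hS

/-- **`(w, x, v) ↦ f̂_{w,x}(v)` is jointly measurable.** -/
theorem measurable_cellLaw_param (h δ : ℝ) :
    Measurable fun a : (Cfg N × T3) × V3 => cellLaw N ψ h δ a.1.1 a.1.2 a.2 := by
  have hv : ∀ i : Fin (N + 1), Measurable fun a : (Cfg N × T3) × V3 => (a.1.1 i).2 := fun i =>
    (measurable_vel_param i).comp measurable_fst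
  have hg : ∀ i : Fin (N + 1), Measurable fun a : (Cfg N × T3) × V3 => gauss h (a.1.1 i).2 a.2 := fun i =>
    EntropyBudget.measurable_lM_param measurable_const (hv i) measurable_snd
  have hcw : ∀ i : Fin (N + 1), Measurable fun a : (Cfg N × T3) × V3 => cw N ψ a.1.1 a.1.2 i := fun i =>
    (measurable_cw_param hψc i).comp measurable_fst
  have hcW : Measurable fun a : (Cfg N × T3) × V3 => (cW N ψ a.1.1 a.1.2)⁻¹ :=
    ((measurable_cW_param hψc).comp measurable_fst).inv
  have hk : Measurable fun a : (Cfg N × T3) × V3 => kde N ψ h a.1.1 a.1.2 a.2 :=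
    hcW.mul (Finset.measurable_sum _ fun i _ => (hcw i).mul (hg i))
  have hθ : Measurable fun a : (Cfg N × T3) × V3 => cT N ψ a.1.1 a.1.2 + h ^ 2 :=
    ((measurable_cT_param hψc).comp measurable_fst).add_const _
  have hu : Measurable fun a : (Cfg N × T3) × V3 => cU N ψ a.1.1 a.1.2 := (measurable_cU_param hψc).comp measurable_fst
  have hM : Measurable fun a : (Cfg N × T3) × V3 =>
      localMaxwellian 1 (cT N ψ a.1.1 a.1.2 + h ^ 2) (cU N ψ a.1.1 a.1.2) a.2 :=
    EntropyBudget.measurable_lM_param hθ hu measurable_snd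
  exact (hk.const_mul _).add (hM.const_mul _)

/-- Measurability of `f̂` composed with measurable parameters and argument. -/
theorem measurable_cellLaw_comp (h δ : ℝ) {α : Type*} [MeasurableSpace α] {W : α → Cfg N} {X : α → T3} {V : α → V3}
    (hW : Measurable W) (hX : Measurable X) (hV : Measurable V) :
    Measurable fun a => cellLaw N ψ h δ (W a) (X a) (V a) := by
  have hT : Measurable fun a => ((W a, X a), V a) := (hW.prodMk hX).prodMk hV
  have hc := (measurable_cellLaw_param hψc h δ).comp hT
  exact hc

/-- The flux integrand `((w,x), q) ↦ B(q) f̂(v) f̂(v_*)` is measurable. -/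
theorem measurable_fluxIntegrand_param (h δ : ℝ) :
    Measurable fun c : (Cfg N × T3) × PairDir =>
      hardSphereKernel c.2.1 c.2.2 * (cellLaw N ψ h δ c.1.1 c.1.2 c.2.1.1 * cellLaw N ψ h δ c.1.1 c.1.2 c.2.1.2) := by
  have hB : Measurable fun c : (Cfg N × T3) × PairDir => hardSphereKernel c.2.1 c.2.2 :=
    DVTransfer.continuous_hardSphereKernel_pairDir.measurable.comp measurable_snd
  have h1 : Measurable fun c : (Cfg N × T3) × PairDir => cellLaw N ψ h δ c.1.1 c.1.2 c.2.1.1 :=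
    measurable_cellLaw_comp hψc h δ measurable_fst.fst measurable_fst.snd measurable_snd.fst.fst
  have h2 : Measurable fun c : (Cfg N × T3) × PairDir => cellLaw N ψ h δ c.1.1 c.1.2 c.2.1.2 :=
    measurable_cellLaw_comp hψc h δ measurable_fst.fst measurable_fst.snd measurable_snd.fst.snd
  exact hB.mul (h1.mul h2)

/-- The Hellinger integrand `((w,x), q) ↦ B(q) (√(f̂′f̂′_*) − √(f̂ f̂_*))²` is measurable. -/
theorem measurable_hellIntegrand_param (h δ : ℝ) :
    Measurable fun c : (Cfg N × T3) × PairDir => hardSphereKernel c.2.1 c.2.2 *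
      (Real.sqrt (cellLaw N ψ h δ c.1.1 c.1.2 (collide c.2.2 c.2.1).1 * cellLaw N ψ h δ c.1.1 c.1.2 (collide c.2.2 c.2.1).2) -
        Real.sqrt (cellLaw N ψ h δ c.1.1 c.1.2 c.2.1.1 * cellLaw N ψ h δ c.1.1 c.1.2 c.2.1.2)) ^ 2 := by
  have hB : Measurable fun c : (Cfg N × T3) × PairDir => hardSphereKernel c.2.1 c.2.2 :=
    DVTransfer.continuous_hardSphereKernel_pairDir.measurable.comp measurable_snd
  have hc : Measurable fun c : (Cfg N × T3) × PairDir => collide c.2.2 c.2.1 :=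
    continuous_collide_uncurry.measurable.comp measurable_snd
  have h1 : Measurable fun c : (Cfg N × T3) × PairDir => cellLaw N ψ h δ c.1.1 c.1.2 c.2.1.1 :=
    measurable_cellLaw_comp hψc h δ measurable_fst.fst measurable_fst.snd measurable_snd.fst.fst
  have h2 : Measurable fun c : (Cfg N × T3) × PairDir => cellLaw N ψ h δ c.1.1 c.1.2 c.2.1.2 :=
    measurable_cellLaw_comp hψc h δ measurable_fst.fst measurable_fst.snd measurable_snd.fst.snd
  have h3 : Measurable fun c : (Cfg N × T3) × PairDir => cellLaw N ψ h δ c.1.1 c.1.2 (collide c.2.2 c.2.1).1 :=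
    measurable_cellLaw_comp hψc h δ measurable_fst.fst measurable_fst.snd hc.fst
  have h4 : Measurable fun c : (Cfg N × T3) × PairDir => cellLaw N ψ h δ c.1.1 c.1.2 (collide c.2.2 c.2.1).2 :=
    measurable_cellLaw_comp hψc h δ measurable_fst.fst measurable_fst.snd hc.snd
  exact hB.mul (((h3.mul h4).sqrt.sub (h1.mul h2).sqrt).pow_const 2)

omit hψc in
/-- The pair-space measure is s-finite (product of two sigma-finite Lebesgue measures and the finite surface measure). -/
theorem sFinite_pairDirMeasure : SFinite pairDirMeasure := by
  have h1 : SFinite (sphereMeasure : Measure (Metric.sphere (0 : V3) 1)) := by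
    have := isFiniteMeasure_sphereMeasure (E := V3); infer_instance
  unfold pairDirMeasure
  exact Measure.prod.instSFinite

/-- **`(w, x) ↦ 𝒟h(f̂_{w,x})` is measurable** (parametric Bochner integrals over the s-finite pair space). -/
theorem measurable_hellDiss_cellLaw (h δ : ℝ) :
    Measurable fun a : Cfg N × T3 => hellDiss (cellLaw N ψ h δ a.1 a.2) := by
  haveI := sFinite_pairDirMeasure
  have hZ : StronglyMeasurable fun a : Cfg N × T3 => fluxZ (cellLaw N ψ h δ a.1 a.2) := by
    unfold fluxZ
    exact (measurable_fluxIntegrand_param hψc h δ).stronglyMeasurable.integral_prod_right'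
  have hI : StronglyMeasurable fun a : Cfg N × T3 => ∫ q : PairDir, hardSphereKernel q.1 q.2 *
      (Real.sqrt (cellLaw N ψ h δ a.1 a.2 (collide q.2 q.1).1 * cellLaw N ψ h δ a.1 a.2 (collide q.2 q.1).2) -
        Real.sqrt (cellLaw N ψ h δ a.1 a.2 q.1.1 * cellLaw N ψ h δ a.1 a.2 q.1.2)) ^ 2 ∂pairDirMeasure :=
    (measurable_hellIntegrand_param hψc h δ).stronglyMeasurable.integral_prod_right'
  unfold hellDiss
  exact (hZ.measurable.const_mul 2).inv.mul hI.measurable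

end Param

/-! ## Along a good orbit -/

section Orbit

variable {σ : ℝ} {Φ : Flow σ N} {z : Cfg N} (hz : z ∈ Φ.good) (hψc : Continuous (ψ N))
include hz hψc

omit hψc in
/-- `(s, x) ↦ (Φ_s z, x)` is measurable for a good `z`. -/
theorem measurable_flow_prod : Measurable fun p : ℝ × T3 => (Φ.flow p.1 z, p.2) :=
  ((measurable_flow_of_mem_good Φ hz).comp measurable_fst).prodMk measurable_snd

/-- `(s, x) ↦ 𝒟h(f̂_{s,x})` is jointly measurable along a good orbit. -/
theorem measurable_hellDiss_orbit (h δ : ℝ) :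
    Measurable fun p : ℝ × T3 => hellDiss (cellLaw N ψ h δ (Φ.flow p.1 z) p.2) := by
  have hF : Measurable fun p : ℝ × T3 => (Φ.flow p.1 z, p.2) := measurable_flow_prod hz
  have h2 := (measurable_hellDiss_cellLaw hψc h δ).comp hF
  exact h2

/-- `(s, x) ↦ W_x(Φ_s z)` is jointly measurable along a good orbit. -/
theorem measurable_cW_orbit : Measurable fun p : ℝ × T3 => cW N ψ (Φ.flow p.1 z) p.2 := by
  have hF : Measurable fun p : ℝ × T3 => (Φ.flow p.1 z, p.2) := measurable_flow_prod hz
  have h1 := (measurable_cW_param hψc).comp hF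
  exact h1

/-- **The mass-weighted dissipation density `(s, x) ↦ ρ̄_s(x) 𝒟h(f̂_{s,x})` is jointly measurable.** -/
theorem measurable_massDissDensity (h δ : ℝ) :
    Measurable fun p : ℝ × T3 => ((N + 1 : ℕ) : ℝ)⁻¹ * cW N ψ (Φ.flow p.1 z) p.2 *
      hellDiss (cellLaw N ψ h δ (Φ.flow p.1 z) p.2) :=
  ((measurable_cW_orbit hz hψc).const_mul (((N + 1 : ℕ) : ℝ)⁻¹)).mul (measurable_hellDiss_orbit hz hψc h δ)

/-- The mass-weighted density of an observable of the velocities,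
`(s, x) ↦ (N+1)⁻¹ Σ_i ψ_N(x_i(s) − x) g(v_i(s))`, is jointly measurable for continuous `g`. -/
theorem measurable_weightedDensity {g : V3 → ℝ} (hg : Continuous g) :
    Measurable fun p : ℝ × T3 => ((N + 1 : ℕ) : ℝ)⁻¹ * ∑ i, cw N ψ (Φ.flow p.1 z) p.2 i * g ((Φ.flow p.1 z i).2) := by
  refine (Finset.measurable_sum _ fun i _ => ?_).const_mul _
  exact ((measurable_cw_param hψc i).comp (measurable_flow_prod hz)).mul
    (hg.measurable.comp ((Geometry.IsMeasurable.measurable_vel i).comp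
      ((measurable_flow_of_mem_good Φ hz).comp measurable_fst)))

end Orbit

/-! ## Bounds and genuine iterated integrals -/

section Integrals

variable {σ : ℝ} {Φ : Flow σ N} {z : Cfg N} {Cψ : ℝ}

/-- Weighted cell averages of a bounded kernel: `|(N+1)⁻¹ Σ_i ψ_N(x_i − x) a_i| ≤ Cψ · A` if `0 ≤ ψ_N ≤ Cψ`, `|a_i| ≤ A`. -/
theorem abs_weightedAvg_le (hψ0 : ∀ y, 0 ≤ ψ N y) (hψC : ∀ y, ψ N y ≤ Cψ) (w : Cfg N) (x : T3)
    {a : Fin (N + 1) → ℝ} {A : ℝ} (ha : ∀ i, |a i| ≤ A) :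
    |((N + 1 : ℕ) : ℝ)⁻¹ * ∑ i, cw N ψ w x i * a i| ≤ Cψ * A := by
  have hN : (0 : ℝ) < ((N + 1 : ℕ) : ℝ) := by positivity
  have hA : 0 ≤ A := (abs_nonneg _).trans (ha 0)
  have hC : 0 ≤ Cψ := (hψ0 0).trans (hψC 0)
  rw [abs_mul, abs_of_pos (inv_pos.2 hN)]
  have hsum : |∑ i, cw N ψ w x i * a i| ≤ ∑ _i : Fin (N + 1), Cψ * A := by
    refine (Finset.abs_sum_le_sum_abs _ _).trans (Finset.sum_le_sum fun i _ => ?_)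
    rw [abs_mul, abs_of_nonneg (show 0 ≤ cw N ψ w x i from hψ0 _)]
    exact mul_le_mul (show cw N ψ w x i ≤ Cψ from hψC _) (ha i) (abs_nonneg _) hC
  rw [Finset.sum_const, Finset.card_univ, Fintype.card_fin, nsmul_eq_mul] at hsum
  calc ((N + 1 : ℕ) : ℝ)⁻¹ * |∑ i, cw N ψ w x i * a i| ≤ ((N + 1 : ℕ) : ℝ)⁻¹ * (((N + 1 : ℕ) : ℝ) * (Cψ * A)) :=
        mul_le_mul_of_nonneg_left hsum (inv_nonneg.2 hN.le)
    _ = Cψ * A := by field_simp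

/-- **`massDiss` has genuine iterated integrals**: for a good `z`, a continuous kernel with `0 ≤ ψ_N ≤ Cψ` and
`δ ∈ [0, 1]`, the density `ρ̄ 𝒟h(f̂)` is integrable in `x` for every `s` and `s ↦ ∫ₓ ρ̄ 𝒟h` is integrable on `[0, t]`. -/
theorem integrable_massDissDensity (hz : z ∈ Φ.good) (hψc : Continuous (ψ N)) (hψ0 : ∀ N y, 0 ≤ ψ N y)
    (hψC : ∀ y, ψ N y ≤ Cψ) {h δ : ℝ} (hδ0 : 0 ≤ δ) (hδ1 : δ ≤ 1) (t : ℝ) :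
    (∀ s ∈ Icc 0 t, Integrable fun x => ((N + 1 : ℕ) : ℝ)⁻¹ * cW N ψ (Φ.flow s z) x *
        hellDiss (cellLaw N ψ h δ (Φ.flow s z) x)) ∧
      IntegrableOn (fun s => ∫ x, ((N + 1 : ℕ) : ℝ)⁻¹ * cW N ψ (Φ.flow s z) x *
        hellDiss (cellLaw N ψ h δ (Φ.flow s z) x)) (Icc 0 t) := by
  refine integrable_of_bdd t (fun s x => ((N + 1 : ℕ) : ℝ)⁻¹ * cW N ψ (Φ.flow s z) x *
      hellDiss (cellLaw N ψ h δ (Φ.flow s z) x)) (measurable_massDissDensity hz hψc h δ) ⟨Cψ * 1, fun s _ x => ?_⟩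
  have h0 := ContactToMass.cW_mul_hellDiss_nonneg hψ0 hδ0 hδ1 h (Φ.flow s z) x
  have h1 := ContactToMass.cW_mul_hellDiss_le hψ0 hδ0 hδ1 h (Φ.flow s z) x
  rw [abs_of_nonneg h0]
  refine h1.trans ?_
  have h2 := abs_weightedAvg_le (hψ0 N) hψC (Φ.flow s z) x (a := fun _ => (1 : ℝ)) (A := 1) (fun i => by simp)
  have h3 : ((N + 1 : ℕ) : ℝ)⁻¹ * cW N ψ (Φ.flow s z) x = ((N + 1 : ℕ) : ℝ)⁻¹ * ∑ i, cw N ψ (Φ.flow s z) x i * 1 := by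
    simp only [mul_one]; rfl
  rw [h3]
  exact (le_abs_self _).trans h2

/-- **Genuine iterated integrals of mass-weighted velocity observables** along a good orbit: for continuous `g`
bounded on the orbit's velocity ball (`|g(v)| ≤ A` whenever `|v| ≤ vR z`), the density
`(N+1)⁻¹ Σ_i ψ_N(x_i(s) − x) g(v_i(s))` is integrable in `x` for each `s` and `s ↦ ∫ₓ` is integrable on `[0, t]`. -/
theorem integrable_weightedDensity (hz : z ∈ Φ.good) (hψc : Continuous (ψ N)) (hψ0 : ∀ N y, 0 ≤ ψ N y)
    (hψC : ∀ y, ψ N y ≤ Cψ) {g : V3 → ℝ} (hg : Continuous g) {A : ℝ}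
    (hA : ∀ v : V3, ‖v‖ ≤ vR z → |g v| ≤ A)
    (t : ℝ) :
    (∀ s ∈ Icc 0 t, Integrable fun x => ((N + 1 : ℕ) : ℝ)⁻¹ * ∑ i, cw N ψ (Φ.flow s z) x i * g ((Φ.flow s z i).2)) ∧
      IntegrableOn (fun s => ∫ x, ((N + 1 : ℕ) : ℝ)⁻¹ * ∑ i, cw N ψ (Φ.flow s z) x i * g ((Φ.flow s z i).2))
        (Icc 0 t) :=
  integrable_of_bdd t (fun s x => ((N + 1 : ℕ) : ℝ)⁻¹ * ∑ i, cw N ψ (Φ.flow s z) x i * g ((Φ.flow s z i).2))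
    (measurable_weightedDensity hz hψc hg) ⟨Cψ * A, fun s _ x =>
      abs_weightedAvg_le (hψ0 N) hψC (Φ.flow s z) x fun i =>
        hA _ (norm_vel_flow_le Φ hz s i)⟩

/-- The `x`-integral of a mass-weighted density is the particle average: `∫ₓ (N+1)⁻¹ Σ_i ψ_N(x_i − x) a_i = (N+1)⁻¹ Σ a_i`
for an admissible kernel family. -/
theorem integral_weightedDensity {γ C : ℝ} (hadm : AdmissibleKernel γ C ψ) (Φ : Flow σ N) (s : ℝ)
    (z : Cfg N) (a : Fin (N + 1) → ℝ) :
    ∫ x, ((N + 1 : ℕ) : ℝ)⁻¹ * ∑ i, cw N ψ (Φ.flow s z) x i * a i = ((N + 1 : ℕ) : ℝ)⁻¹ * ∑ i, a i := by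
  rw [integral_const_mul]
  congr 1
  exact integral_sum_wgt_mul Φ hadm s z a

end Integrals

end EEP

/-- Registered anchor of this helper file: `(w, x) ↦ 𝒟h(f̂_{w,x})` is measurable for a continuous cell kernel
(`EEP.measurable_hellDiss_cellLaw`). -/
theorem bhEEPClosure_measurable_anchor : ∀ (N : ℕ) (ψ : ℕ → T3 → ℝ) (h δ : ℝ), Continuous (ψ N) → Measurable fun a : Cfg N × T3 => hellDiss (cellLaw N ψ h δ a.1 a.2) :=
  fun _ _ h δ hψc => EEP.measurable_hellDiss_cellLaw hψc h δ

end

end Summit.AtomisticToContinuum.HydrodynamicLimit.Theorems.BlockHDissipation
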